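import Mathlib
import Summits.CriticalPhenomena.PercolationContinuityZ3.Theorems.PercNearOneGluingNoHeavyLowerTailOrderedDifferencesCopiesTop

/-!
# `θ = 1/2` is an eigenvalue of the Marica–Schönheim pencil modulo every prime `p ≥ 5`

Helper file for crux `stmt-CriticalPhenomena-4575` (`NoHeavyLowerTail`, route `PercNearOneGluingNoHeavy`), new-inequality factory
seat `prim-ineq-gen-3` (gen 31).  Everything here is PROVED; no definitions.  Imports Mathlib and `…OrderedDifferencesCopiesTop`
(`copiesTop_not_linearIndependent_pencil`: the family `k·C(n,n−1) + top` is singular at `θ` as soon as three field identities hold).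
Memo: `run/shared/lean/prim/prim-ineq-gen-3/FINDINGS-gen31.md` §F31-7, `PAPER-PRODUCTS.md` §4.

* `copiesTop_hypotheses_half` — the arithmetic: for a prime `p ≥ 5`, `n = (p+3)/2` and `k = val(1 − n⁻¹) + p` satisfy `k ≥ 2`, `n ≥ 3` and the
  three identities of `copiesTop_not_linearIndependent_pencil` at `θ = 2⁻¹` in `ZMod p` [`2n = p + 3 ≡ 3`, `(k−1)n ≡ −1`, `kn ≡ 1/2`].
* `exists_family_not_linearIndependent_pencil_half` — ★ for every prime `p ≥ 5` some finite family of finite sets (on `Fin k × Fin n`) has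
  linearly dependent pencil rows over `ZMod p` at `θ = 1/2`.  By THEOREM MS-pencil (`…OrderedDifferencesPencil`) no rational `t ≠ ±1` is bad in
  characteristic `0`; here a fixed rational value is bad modulo EVERY prime `≥ 5`, each time for a different family.  With the product
  calculus (`…OrderedDifferencesProductsGroup`): `2, −2, 1/2, −1/2` lie in the bad locus `B(𝔽̄_p)` for all `p ≥ 5`, so `B(𝔽̄_p) ⊇ ⟨−1, 2⟩`.
(prim-ineq-gen-3 gen 31, 2026-08-26.)
-/

namespace Summit.CriticalPhenomena.PercolationContinuityZ3.Theorems

namespace OrderedDifferences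

open Finset
open scoped FinsetFamily

/-- **The arithmetic at `θ = 1/2`.**  For a prime `p ≥ 5`, `n = (p+3)/2` and `k = val(1 − n⁻¹) + p` give `k ≥ 2`, `n ≥ 3` and, in `ZMod p`,
`1 + ½((k−1)n − 1) = 0`, `(n−1) + ½(k−1)n = 0`, `(kn − ½)(1 + ½) = 0`. -/
theorem copiesTop_hypotheses_half (p : ℕ) (hp : p.Prime) (h5 : 5 ≤ p) :
    2 ≤ (1 - ((((p + 3) / 2 : ℕ) : ZMod p))⁻¹).val + p ∧ 3 ≤ (p + 3) / 2 ∧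
    (1 + (2 : ZMod p)⁻¹ * (((((1 - ((((p + 3) / 2 : ℕ) : ZMod p))⁻¹).val + p : ℕ) : ZMod p) - 1) * (((p + 3) / 2 : ℕ) : ZMod p) - 1) = 0) ∧
    (((((p + 3) / 2 : ℕ) : ZMod p) - 1) +
      (2 : ZMod p)⁻¹ * (((((1 - ((((p + 3) / 2 : ℕ) : ZMod p))⁻¹).val + p : ℕ) : ZMod p) - 1) * (((p + 3) / 2 : ℕ) : ZMod p)) = 0) ∧
    (((((1 - ((((p + 3) / 2 : ℕ) : ZMod p))⁻¹).val + p : ℕ) : ZMod p) * (((p + 3) / 2 : ℕ) : ZMod p) - (2 : ZMod p)⁻¹) *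
      (1 + (2 : ZMod p)⁻¹) = 0) := by
  haveI : Fact p.Prime := ⟨hp⟩
  set n : ℕ := (p + 3) / 2 with hn
  set x : ZMod p := 1 - ((n : ℕ) : ZMod p)⁻¹ with hx
  refine ⟨by omega, by omega, ?_⟩
  -- casts
  have hk : (((x.val + p : ℕ)) : ZMod p) = x := by
    push_cast
    rw [ZMod.natCast_zmod_val, ZMod.natCast_self, add_zero]
  have h2n : (2 : ZMod p) * (n : ZMod p) = 3 := by
    have hev : 2 * n = p + 3 := by
      have hodd : p % 2 = 1 := Nat.odd_iff.mp (hp.odd_of_ne_two (by omega))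
      omega
    have := congrArg (fun m : ℕ => (m : ZMod p)) hev
    push_cast at this
    rw [ZMod.natCast_self, zero_add] at this
    exact this
  have two_ne : (2 : ZMod p) ≠ 0 := by
    intro h
    have : ((2 : ℕ) : ZMod p) = 0 := by exact_mod_cast h
    rw [ZMod.natCast_eq_zero_iff] at this
    exact absurd (Nat.le_of_dvd (by norm_num) this) (by omega)
  have three_ne : (3 : ZMod p) ≠ 0 := by
    intro h
    have : ((3 : ℕ) : ZMod p) = 0 := by exact_mod_cast h
    rw [ZMod.natCast_eq_zero_iff] at this
    exact absurd (Nat.le_of_dvd (by norm_num) this) (by omega)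
  have n_ne : (n : ZMod p) ≠ 0 := by
    intro h; rw [h, mul_zero] at h2n; exact three_ne h2n.symm
  set u : ZMod p := (2 : ZMod p)⁻¹ with hu
  have hu2 : (2 : ZMod p) * u = 1 := mul_inv_cancel₀ two_ne
  have hnu : (n : ZMod p) = 3 * u := by
    have : (n : ZMod p) = u * ((2 : ZMod p) * (n : ZMod p)) := by
      rw [← mul_assoc, hu, inv_mul_cancel₀ two_ne, one_mul]
    rw [this, h2n, mul_comm]
  have hkn : (x - 1) * (n : ZMod p) = -1 := by
    rw [hx]
    have : (1 - ((n : ℕ) : ZMod p)⁻¹ - 1) = -((n : ZMod p)⁻¹) := by ring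
    rw [this, neg_mul, inv_mul_cancel₀ n_ne]
  rw [hk]
  refine ⟨?_, ?_, ?_⟩
  · linear_combination u * hkn - hu2
  · linear_combination u * hkn + hnu + hu2
  · have hfac : x * (n : ZMod p) - u = 0 := by linear_combination hkn + hnu + hu2
    rw [hfac, zero_mul]

/-- ★ **`θ = 1/2` is a bad value modulo every prime `p ≥ 5`.**  For every prime `p ≥ 5` there are `k ≥ 2`, `n ≥ 3` such that the pencil rows
`C ↦ (E ↦ [E ⊆ C] + ½ [E ∩ C = ∅])` of the family `k·C(n,n−1) + top` on `Fin k × Fin n` (over its difference set) are linearly dependent over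
`ZMod p`. -/
theorem exists_family_not_linearIndependent_pencil_half (p : ℕ) (hp : p.Prime) (h5 : 5 ≤ p) :
    ∃ k n : ℕ, 2 ≤ k ∧ 3 ≤ n ∧
      ¬ LinearIndependent (ZMod p) (fun A : (insert (univ : Finset (Fin k × Fin n))
          ((univ : Finset (Fin k × Fin n)).image fun q => (univ : Finset (Fin k × Fin n)).filter (fun x => x.1 = q.1 ∧ x.2 ≠ q.2)) :
            Finset (Finset (Fin k × Fin n))) =>
        fun E : ((insert (univ : Finset (Fin k × Fin n))
          ((univ : Finset (Fin k × Fin n)).image fun q => (univ : Finset (Fin k × Fin n)).filter (fun x => x.1 = q.1 ∧ x.2 ≠ q.2))) \\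
          (insert (univ : Finset (Fin k × Fin n))
          ((univ : Finset (Fin k × Fin n)).image fun q => (univ : Finset (Fin k × Fin n)).filter (fun x => x.1 = q.1 ∧ x.2 ≠ q.2)))
            : Finset (Finset (Fin k × Fin n))) =>
        (if (E : Finset (Fin k × Fin n)) ⊆ (A : Finset (Fin k × Fin n)) then (1 : ZMod p) else 0) +
          (2 : ZMod p)⁻¹ * (if Disjoint (E : Finset (Fin k × Fin n)) (A : Finset (Fin k × Fin n)) then (1 : ZMod p) else 0)) := by
  haveI : Fact p.Prime := ⟨hp⟩
  obtain ⟨hk, hn, h1, h2, h3⟩ := copiesTop_hypotheses_half p hp h5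
  exact ⟨_, _, hk, hn, copiesTop_not_linearIndependent_pencil hk hn _ h1 h2 h3⟩

end OrderedDifferences

end Summit.CriticalPhenomena.PercolationContinuityZ3.Theorems
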